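import Mathlib.Analysis.SpecialFunctions.Pow.NNReal
import HarnessLib

/-!
# Volkov 2020 (NPB 961, 115232) §3.2 eq. (3.4), FIRST relation, with REAL weights: `|W|^M ≥ C^M · ∏_i w_i^{r_i}` (`M = Σ_i r_i`, `r_i ≥ 0` real) from Lemma 3.4's «|W| ≥ C·w_i for every photon i», and its reciprocal «mixture-majorant» form `|W|^{−b} ≤ C^{−b} · ∏_i w_i^{−b θ_i}` — PROVED

independent recomputation; certified where stated, statistical where stated; no new-physics claim.

CITATION HEADER (venture `QEDPrecision`, cell `qed-hepp` (HOME `run/shared/lean/pub/qed-hepp/`), literature seat `qed-hepp-lit` gen 7;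
VALUE-FREE: two elementary inequalities of real analysis on the SHAPE of one printed display — no circuit, no graph, nothing per word or per
Set-V family). Fourth `Volkov2020` §3.2 companion, after `DenominatorLemmaArithmetic` (the arithmetic skeleton of Lemma 3.4),
`DenominatorSectorExponent` (eq. (3.4)'s SECOND relation `∏_i (…)^{r_i} = ∏_l t_l^{a_l}` for NATURAL weights `r_i`, whose header records
«real weights r_i ≥ 0 are a `-- TODO(general form)` (`rpow`), the file takes r_i ∈ ℕ») and `HeppSectorTreeBounds` (Lemmas 3.1–3.3). Serves the
qed-hepp theory seat's signature sketch `HOME/theory/lean/Sketch.lean` — `mixture_majorant` («If `κ·w i ≤ W` for every photon factor and θ is a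
probability vector then `W^{-b} ≤ κ^{-b} ∏ (w i)^{-b θ_i}` (weighted AM–GM; BND (5.1))», `sorry` there) = `HOME/theory/BOUNDEDNESS.md` §5.1
eq. (5.1), the step that turns Volkov's max-form denominator bound into ONE monomial majorant per Hepp cone; a theorem here, with the sketch's
exact signature.

Source. [Volkov2020] S. Volkov, "Infrared and ultraviolet power counting on the mass shell in quantum electrodynamics", Nucl. Phys. B 961 (2020)
115232 = arXiv:1912.04885v4, §3.2 (journal p.12–13; e-print tex l.361–405, held by the pub-qed cell under `pub-qed-trop-v3-lit-2/sources/
arxiv-1912.04885/` and transcribed VERBATIM in the companion headers): **Lemma 3.4** «The following inequality is satisfied [fn 23: This inequality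
works in both directions too.] for (2.3): |W(z)| ≥ C · max_{i∈Ph(E(G))} (z′_i)²/max(z′_i, z_i) (3.3), where z′_i = max_{l∈LPath(i)} z_l, C > 0 is
some constant depending only on the structure of the graph (and m).» **Eq. (3.4)** «Let us describe an idea how to transform the estimation from
Lemma 3.4 to the form like ∏ t_l^{d_l}. If r_i ≥ 0, i ∈ Ph(E(G)) are some real numbers, M = Σ_i r_i, then we have
|W(z)|^M ≥ C·∏_{i∈Ph(E(G))} ((z′_i)²/max(z′_i, z_i))^{r_i} = C·∏_{l=1}^{L} t_l^{a_l}, (3.4)».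

WHAT IS PROVED (pure `Real.rpow` arithmetic; the photon factors enter as abstract reals `w i ≥ 0` together with the per-photon consequence
`C * w i ≤ W` of (3.3) — «max_i ≥ each term»; `ι` = the finite index set Ph(E(G))):
* `rpow_sum_mul_prod_rpow_le` — the FIRST relation of (3.4) for REAL weights `r i ≥ 0`: `C ^ (Σ_i r i) * ∏_i (w i) ^ (r i) ≤ W ^ (Σ_i r i)`
  (Volkov's «C» in (3.4) is a generic structure constant; written out it is (3.3)'s C to the power M);
* `mul_prod_rpow_le_of_sum_eq_one` — the normalised case `Σ_i θ i = 1`: `C * ∏_i (w i) ^ (θ i) ≤ W`;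
* `mixture_majorant` — the reciprocal form of BOUNDEDNESS.md (5.1): for `b ≥ 0`, `W ^ (−b) ≤ κ ^ (−b) * ∏_i (w i) ^ (−(b * θ i))`, with exactly
  the hypotheses of the theory seat's sketch (`0 < w i`, `0 < κ`, `κ * w i ≤ W`, `θ ≥ 0`, `Σ θ = 1`, `ι` non-empty).
Proof = the printed one-liner: `W ^ (Σ r) = ∏_i W ^ (r i) ≥ ∏_i (C * w i) ^ (r i) = C ^ (Σ r) * ∏_i (w i) ^ (r i)` (monotonicity of `x ↦ x ^ r`
for `r ≥ 0`), then `x ↦ x ^ (−b)` is antitone on `(0, ∞)`.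
NOT claimed: Lemma 3.4 itself (Rayleigh monotonicity of circuit resistances — `DenominatorLemmaArithmetic` has the arithmetic, the circuit facts
stay hypotheses there), the SECOND relation of (3.4) (`DenominatorSectorExponent.prod_wFactor_pow_eq_prod_pow_aExpIntended`, natural weights;
the real-weight product form would follow from `wFactor_eq` the same way and is not needed by the cell), anything per graph.
-/

namespace Literature.MathematicalPhysics.QuantumFieldTheory.Volkov2020

open Finset Real

section RealWeights

variable {ι : Type*} [Fintype ι]

/-- **Eq. (3.4), first relation, REAL weights.** From `C * w i ≤ W` for every photon `i` (Lemma 3.4's (3.3), factor by factor), `C ≥ 0`,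
`w i ≥ 0` and real weights `r i ≥ 0` with `M = Σ_i r i`: `C^M · ∏_i (w i)^{r i} ≤ W^M`.
[cite: Volkov2020, §3.2 eq. (3.4), first relation (journal p.13; tex l.396–405); Lemma 3.4 eq. (3.3) (journal p.12)] -/
theorem rpow_sum_mul_prod_rpow_le (w : ι → ℝ) (hw : ∀ i, 0 ≤ w i) {W C : ℝ} (hC : 0 ≤ C)
    (hW : ∀ i, C * w i ≤ W) (r : ι → ℝ) (hr : ∀ i, 0 ≤ r i) :
    C ^ (∑ i, r i) * ∏ i, w i ^ r i ≤ W ^ (∑ i, r i) := by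
  rcases isEmpty_or_nonempty ι with hι | hι
  · simp
  have hW0 : 0 ≤ W := by
    obtain ⟨i⟩ := hι
    exact le_trans (mul_nonneg hC (hw i)) (hW i)
  calc C ^ (∑ i, r i) * ∏ i, w i ^ r i
      = (∏ i, C ^ r i) * ∏ i, w i ^ r i := by
        rw [rpow_sum_of_nonneg hC (fun i _ => hr i)]
    _ = ∏ i, (C * w i) ^ r i := by
        rw [← Finset.prod_mul_distrib]
        exact Finset.prod_congr rfl (fun i _ => (mul_rpow hC (hw i)).symm)
    _ ≤ ∏ i, W ^ r i :=
        Finset.prod_le_prod (fun i _ => rpow_nonneg (mul_nonneg hC (hw i)) _)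
          (fun i _ => rpow_le_rpow (mul_nonneg hC (hw i)) (hW i) (hr i))
    _ = W ^ (∑ i, r i) := (rpow_sum_of_nonneg hW0 (fun i _ => hr i)).symm

/-- The normalised case of eq. (3.4)'s first relation: for a probability vector `θ` (`θ ≥ 0`, `Σ θ = 1`), `C · ∏_i (w i)^{θ i} ≤ W` —
the weighted geometric mean of the photon factors is dominated by `W/C`.
[cite: Volkov2020, §3.2 eq. (3.4), first relation with M = 1 (journal p.13; tex l.396–405)] -/
theorem mul_prod_rpow_le_of_sum_eq_one (w : ι → ℝ) (hw : ∀ i, 0 ≤ w i) {W C : ℝ} (hC : 0 ≤ C)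
    (hW : ∀ i, C * w i ≤ W) (θ : ι → ℝ) (hθ : ∀ i, 0 ≤ θ i) (hθ1 : ∑ i, θ i = 1) :
    C * ∏ i, w i ^ θ i ≤ W := by
  have h := rpow_sum_mul_prod_rpow_le w hw hC hW θ hθ
  rwa [hθ1, rpow_one, rpow_one] at h

/-- **The mixture majorant (qed-hepp BOUNDEDNESS.md (5.1); theory seat's `Sketch.lean` `mixture_majorant`, same signature).** If `κ · w i ≤ W`
for every photon factor (`κ > 0`, `w i > 0`), `θ` is a probability vector and `b ≥ 0`, then `W^{−b} ≤ κ^{−b} · ∏_i (w i)^{−(b θ_i)}`: eq. (3.4)'s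
first relation with `M = 1`, followed by the antitonicity of `x ↦ x^{−b}` on `(0, ∞)`. Combine with `DenominatorSectorExponent.wFactor_eq` (each
`w i` is a Hepp-sector monomial) to get ONE monomial majorant of `1/|W|^b` per sector and per choice of `θ`.
[cite: Volkov2020, §3.2 Lemma 3.4 eq. (3.3) and eq. (3.4) (journal p.12–13; tex l.361–405)] -/
theorem mixture_majorant [Nonempty ι] (w : ι → ℝ) (hw : ∀ i, 0 < w i) (W κ b : ℝ)
    (hκ : 0 < κ) (hb : 0 ≤ b) (hW : ∀ i, κ * w i ≤ W) (θ : ι → ℝ) (hθ : ∀ i, 0 ≤ θ i) (hθ1 : ∑ i, θ i = 1) :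
    W ^ (-b) ≤ κ ^ (-b) * ∏ i, w i ^ (-(b * θ i)) := by
  have hprod_pos : 0 < ∏ i, w i ^ θ i := Finset.prod_pos (fun i _ => rpow_pos_of_pos (hw i) _)
  have hlow : κ * ∏ i, w i ^ θ i ≤ W :=
    mul_prod_rpow_le_of_sum_eq_one w (fun i => (hw i).le) hκ.le hW θ hθ hθ1
  have hpos : 0 < κ * ∏ i, w i ^ θ i := mul_pos hκ hprod_pos
  calc W ^ (-b) ≤ (κ * ∏ i, w i ^ θ i) ^ (-b) := rpow_le_rpow_of_nonpos hpos hlow (neg_nonpos.mpr hb)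
    _ = κ ^ (-b) * (∏ i, w i ^ θ i) ^ (-b) := mul_rpow hκ.le hprod_pos.le
    _ = κ ^ (-b) * ∏ i, (w i ^ θ i) ^ (-b) := by
        rw [← Real.finsetProd_rpow _ _ (fun i _ => (rpow_pos_of_pos (hw i) _).le)]
    _ = κ ^ (-b) * ∏ i, w i ^ (-(b * θ i)) := by
        congr 1
        refine Finset.prod_congr rfl (fun i _ => ?_)
        rw [← rpow_mul (hw i).le]
        congr 1
        ring

/-- Sanity instance (two photon factors, `θ = (½, ½)`, `b = 1`): from `κ w₁ ≤ W`, `κ w₂ ≤ W` the geometric-mean majorant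
`W⁻¹ ≤ κ⁻¹ (w₁ w₂)^{−1/2}` in `rpow` form. [cite: Volkov2020, §3.2 eq. (3.4) (journal p.13)] -/
example (w₁ w₂ W κ : ℝ) (h₁ : 0 < w₁) (h₂ : 0 < w₂) (hκ : 0 < κ) (hW₁ : κ * w₁ ≤ W) (hW₂ : κ * w₂ ≤ W) :
    W ^ (-(1 : ℝ)) ≤ κ ^ (-(1 : ℝ)) * ∏ i : Fin 2, (![w₁, w₂] i) ^ (-(1 * (1 / 2 : ℝ))) := by
  have h := mixture_majorant (ι := Fin 2) ![w₁, w₂] (by intro i; fin_cases i <;> simp [h₁, h₂]) W κ 1 hκ zero_le_one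
    (by intro i; fin_cases i <;> simp [hW₁, hW₂]) (fun _ => 1 / 2) (fun _ => by norm_num) (by norm_num)
  simpa using h

end RealWeights

end Literature.MathematicalPhysics.QuantumFieldTheory.Volkov2020
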